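import Literature.Geometry.Symplectic.SteinHandleProfileShape
import Literature.Geometry.Symplectic.SteinHandleDomain
import Literature.Geometry.Symplectic.SteinFlatLeviExp
import HarnessLib

/-!
# Eliashberg's handle profile: the inverse profile `h = f⁻¹` and Forstnerič–Kozak's Prop. 3.1

Topic `Literature/Geometry/Symplectic`; proofs file of the fact seat of
`Literature.Geometry.Symplectic.Gompf1998_thm13_twoHandles` (**E2**, `SteinTwoHandles.lean`),
last step of the profile construction (`SteinHandleProfile*.lean`).  Forstnerič–Kozak,
Prop. 3.1 (iv) (= Eliashberg 1990, Lemma 3.4.3): *"the inverse function `f⁻¹ : ℝ₊ → [σ, +∞)`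
is of class `C^∞` and satisfies (3.1) provided that we set `f⁻¹(u) = σ` for
`0 ≤ u ≤ f(σ)`"*; the handlebody is then `K = {x + iy ∈ ℂ² : |x| ≤ f⁻¹(|y|)}` (Cor. 3.2).
For the assembled `C^∞` profile `f = ff ω β⋆ r₀⋆` (slope `fp > 0`, (3.2) at every `t > σ`,
`f = startFn r₀⋆` near `σ`, `f = g = √(λt² + 1)` for `t ≥ ε(1+ω)`), this file constructs
`h = hinv` and proves, under the package `ProfileOK` of the eventual properties established
before (all of which hold for every `λ > 1`, small `ε`, small `ω`: `profileOK_eventually`):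

* `hinv u = σ` for `u ≤ r₀⋆`, `σ < hinv u` and `f (hinv u) = u` for `u > r₀⋆`, `hinv (f t) = t`
  for `t > σ`; `hinv = startInv σ 6 r₀⋆` on `u ≤ f(t₂(1-ω))` (the `C^∞`-flat start) and
  `hinv u = √((u² - 1)/λ)` for `u ≥ g(ε(1+ω))` (the quadric `D_λ`);
* `hinv` is `C^∞` on `ℝ` (`contDiff_hinv`: flat start, and bootstrap `h' = 1/(f' ∘ h)` on
  `u > r₀⋆`), with `h' > 0` on `u > r₀⋆`;
* **(3.1) at every `u`**: `h (h'' + h'³/u) < 1` and `h h'/u < 1` (`hinv_shape_ineq`), from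
  (3.2) by Remark 2.3 (A) (`shape_inverse_iff`) for `u > r₀⋆` and trivially on the constant
  part.

Finally the assembly with the pseudoconvexity criterion of `SteinHandleDomain.lean`
(`exists_handleProfile`: a profile with `HandleProfile h σ r₀`, quadric tail and `h < τ` below —
Forstnerič–Kozak's Cor. 3.2 / Eliashberg's Lemma 3.4.3 for `n = 2`), and the tail agreement
`K ∩ {|x| ≥ τ} = D_λ ∩ {|x| ≥ τ}`, `K ⊂ D_λ ∪ {|x| < τ}` (`handleDomain_eq_quadric_of_le`,
`handleDomain_subset`) used to glue `K` to a domain osculating `D_λ` along the open overlap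
`{|x| > τ}`.

Everything is **proved**; one definition (`hinv`) and the hypothesis package `ProfileOK`, no
named fact.

## References

* F. Forstnerič, J. Kozak, *Strongly pseudoconvex handlebodies*, J. Korean Math. Soc. 40
  (2003), 727–745 (arXiv:math/0305237), Prop. 3.1 (iii), (iv), Cor. 3.2, Remark 2.3 (A).
  [ForstnericKozak2003]
* Ya. Eliashberg, *Topological characterization of Stein manifolds of dimension > 2*,
  Internat. J. Math. 1 (1990), 29–46, Lemma 3.4.3. [Eliashberg1990Stein]
-/

noncomputable section

open Set Filter MeasureTheory intervalIntegral
open scoped Topology ContDiff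

namespace Literature.Geometry.Symplectic

namespace HParam

variable {P : HParam} {om : ℝ}

/-! ### The package of properties of the assembled profile -/

/-- The properties of the assembled profile `f = ff ω β⋆ r₀⋆` used to invert it: smallness of
the parameters, `0 < ω ≤ 1/8`, `f' > 0` on `(σ, ε(1+ω)]`, the inequalities (3.2) at every
`t > σ`, and `r₀⋆ ≥ 1/2`.  All hold eventually (`profileOK_eventually`). [folklore] -/
structure ProfileOK (P : HParam) (om : ℝ) : Prop where
  small : P.Small
  om_pos : 0 < om
  om_le : om ≤ 1 / 8
  fp_pos' : ∀ t, P.σ < t → t ≤ P.ε * (1 + om) → 0 < P.fp om (P.βs om) t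
  shape : ∀ t, P.σ < t →
    1 < P.ff om (P.βs om) (P.r₀s om) t * (P.φ om (P.βs om) t + P.fp om (P.βs om) t ^ 3 / t) ∧
      1 < P.ff om (P.βs om) (P.r₀s om) t * P.fp om (P.βs om) t / t
  half_le_r₀ : 1 / 2 ≤ P.r₀s om

/-- **For every `λ > 1`, small `ε > 0` and small `ω > 0` the assembled profile has all the
properties `ProfileOK`.** [cite: ForstnericKozak2003, Prop. 3.1] -/
theorem profileOK_eventually {l : ℝ} (hl : 1 < l) :
    ∀ᶠ ε in 𝓝[>] (0 : ℝ), ∀ᶠ om in 𝓝[>] (0 : ℝ), ProfileOK (HParam.mk l ε) om := by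
  filter_upwards [shape_eventually hl] with ε hε
  have hs := hε.toSmall
  filter_upwards [fp_pos_le_eventually hs, shape_ineq_eventually hε] with om h0 h1
  obtain ⟨hom, hom8, hb⟩ := h0
  exact
    { small := hs
      om_pos := hom
      om_le := hom8
      fp_pos' := fun t ht htT => (hb t ht htT).1
      shape := h1.2.2
      half_le_r₀ := half_le_r₀s hs hom hom8 hb }

namespace ProfileOK

variable (H : ProfileOK P om)
include H

/-- `σ > 0`. [folklore] -/
theorem σ_pos : 0 < P.σ := H.small.toPos.σ_pos

/-- `σ < r₀⋆` (`σ < 1/2 ≤ r₀⋆`). [folklore] -/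
theorem σ_lt_r₀ : P.σ < P.r₀s om := lt_of_lt_of_le H.small.σ_lt_half H.half_le_r₀

/-- `σ < t₂(1 - ω) < 2σ`. [folklore] -/
theorem σ_lt_ts : P.σ < P.t₂ * (1 - om) ∧ P.t₂ * (1 - om) < 2 * P.σ := by
  have := H.σ_pos; have := H.om_pos; have := H.om_le; rw [t₂_eq]; constructor <;> nlinarith

/-- `σ < ε(1 + ω)`. [folklore] -/
theorem σ_lt_T : P.σ < P.ε * (1 + om) := by
  have := H.small.toPos.σ_lt_ε; have := H.small.toPos.ε_pos; have := H.om_pos; nlinarith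

/-- **`f' > 0` on all of `(σ, ∞)`** (on the tail `f' = g' > 0`). [cite: ForstnericKozak2003, Prop. 3.1] -/
theorem fp_pos {t : ℝ} (ht : P.σ < t) : 0 < P.fp om (P.βs om) t := by
  rcases le_or_gt t (P.ε * (1 + om)) with hT | hT
  · exact H.fp_pos' t ht hT
  · rw [fp_eq_quadric_deriv H.small.toPos H.om_pos H.om_le hT.le]
    have hl : 0 < P.l := by linarith [H.small.toPos.one_lt_l]
    exact div_pos (mul_pos hl (by linarith [H.σ_pos])) (quadric_pos hl.le t)

/-- `f` is continuous on `(σ, ∞)` and has derivative `f'` there. [folklore] -/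
theorem hasDerivAt_f {t : ℝ} (ht : P.σ < t) :
    HasDerivAt (P.ff om (P.βs om) (P.r₀s om)) (P.fp om (P.βs om) t) t :=
  hasDerivAt_ff H.small.toPos H.om_pos H.om_le _ _ ht

/-- **`f` is strictly increasing on `(σ, ∞)`.** [cite: ForstnericKozak2003, Prop. 3.1] -/
theorem strictMonoOn_f : StrictMonoOn (P.ff om (P.βs om) (P.r₀s om)) (Ioi P.σ) := by
  apply strictMonoOn_of_deriv_pos (convex_Ioi P.σ)
  · exact fun t ht => (H.hasDerivAt_f ht).continuousAt.continuousWithinAt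
  · intro t ht
    rw [interior_Ioi] at ht
    rw [(H.hasDerivAt_f ht).deriv]
    exact H.fp_pos ht

/-- `f = startFn r₀⋆` on `(σ, t₂(1-ω)]`, `f = g` on `[ε(1+ω), ∞)`. [folklore] -/
theorem f_eq_startFn {t : ℝ} (ht : P.σ < t) (hts : t ≤ P.t₂ * (1 - om)) :
    P.ff om (P.βs om) (P.r₀s om) t = startFn P.σ 6 (P.r₀s om) t :=
  ff_eq_startFn H.small.toPos H.om_pos H.om_le _ _ ht hts

/-- `f > r₀⋆` on `(σ, ∞)`. [folklore] -/
theorem r₀_lt_f {t : ℝ} (ht : P.σ < t) : P.r₀s om < P.ff om (P.βs om) (P.r₀s om) t := by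
  rcases le_or_gt t (P.ε * (1 + om)) with hT | hT
  · exact ff_ge_r₀ H.small.toPos H.om_pos H.om_le H.fp_pos' ht hT
  · have h1 := ff_ge_r₀ H.small.toPos H.om_pos H.om_le H.fp_pos' H.σ_lt_T le_rfl
    have h2 := H.strictMonoOn_f H.σ_lt_T (lt_trans H.σ_lt_T hT) hT
    exact lt_trans h1 h2

/-- `g t ≥ t` (`λ ≥ 1`). [folklore] -/
theorem le_quadric (t : ℝ) : t ≤ quadric P.l t := by
  have hl : 1 ≤ P.l := H.small.toPos.one_lt_l.le
  rw [quadric]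
  calc t ≤ |t| := le_abs_self t
    _ = Real.sqrt (t ^ 2) := (Real.sqrt_sq_eq_abs t).symm
    _ ≤ Real.sqrt (P.l * t ^ 2 + 1) := Real.sqrt_le_sqrt (by nlinarith [sq_nonneg t])

/-- **Every `u > f(t₂(1-ω))` is a value of `f` on `(t₂(1-ω), ∞)`** (intermediate values; `f = g`
is unbounded). [folklore] -/
theorem exists_preimage {u : ℝ} (hu : P.ff om (P.βs om) (P.r₀s om) (P.t₂ * (1 - om)) < u) :
    ∃ t, P.t₂ * (1 - om) < t ∧ P.ff om (P.βs om) (P.r₀s om) t = u := by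
  obtain ⟨hts, -⟩ := H.σ_lt_ts
  set ts := P.t₂ * (1 - om) with htsdef
  set T := P.ε * (1 + om) with hT
  set b := max T u with hb
  have hTb : T ≤ b := le_max_left _ _
  have htsb : ts ≤ b := by
    have : ts ≤ T := by
      obtain ⟨s1, s2, s3⟩ := H.small.toPos.sizes H.om_pos.le H.om_le
      have hom := H.om_pos
      have e1 : P.t₂ * (1 - om) ≤ P.t₂ * (1 + om) := by nlinarith [H.small.toPos.t₂_pos]
      have e2 : P.η * (1 - om) ≤ P.η * (1 + om) := by nlinarith [H.small.toPos.η_pos]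
      have e3 : P.ε * (1 - om) ≤ P.ε * (1 + om) := by nlinarith [H.small.toPos.ε_pos]
      rw [htsdef, hT]; linarith
    exact this.trans hTb
  have hfb : u ≤ P.ff om (P.βs om) (P.r₀s om) b := by
    rw [ff_eq_quadric H.small.toPos H.om_pos H.om_le hTb]
    exact (le_max_right _ _).trans (H.le_quadric b)
  have hcont : ContinuousOn (P.ff om (P.βs om) (P.r₀s om)) (Icc ts b) := fun x hx =>
    (H.hasDerivAt_f (lt_of_lt_of_le hts hx.1)).continuousAt.continuousWithinAt
  obtain ⟨c, hc, hcu⟩ := intermediate_value_Icc htsb hcont ⟨hu.le, hfb⟩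
  refine ⟨c, lt_of_le_of_ne hc.1 fun h => ?_, hcu⟩
  rw [← h] at hcu; linarith

/-! ### The inverse profile -/

/-- **The inverse profile** `h = f⁻¹`, extended by `σ` below `r₀⋆`: the `C^∞`-flat `startInv`
on `u ≤ f(t₂(1-ω))`, the preimage under `f` above. [cite: ForstnericKozak2003, Prop. 3.1] -/
def _root_.Literature.Geometry.Symplectic.HParam.hinv (P : HParam) (om u : ℝ) : ℝ := by
  classical
  exact if u ≤ P.ff om (P.βs om) (P.r₀s om) (P.t₂ * (1 - om)) then startInv P.σ 6 (P.r₀s om) u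
    else if hex : ∃ t, P.t₂ * (1 - om) < t ∧ P.ff om (P.βs om) (P.r₀s om) t = u then Classical.choose hex
    else 0

omit H in
/-- On `u ≤ f(t₂(1-ω))` the inverse profile is `startInv`. [folklore] -/
theorem hinv_of_le_fts {u : ℝ} (hu : u ≤ P.ff om (P.βs om) (P.r₀s om) (P.t₂ * (1 - om))) :
    P.hinv om u = startInv P.σ 6 (P.r₀s om) u := by
  simp only [hinv, hu, if_true]

/-- Above `f(t₂(1-ω))`: `hinv u > t₂(1-ω)` and `f (hinv u) = u`. [folklore] -/
theorem hinv_spec_of_gt {u : ℝ} (hu : P.ff om (P.βs om) (P.r₀s om) (P.t₂ * (1 - om)) < u) :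
    P.t₂ * (1 - om) < P.hinv om u ∧ P.ff om (P.βs om) (P.r₀s om) (P.hinv om u) = u := by
  have hex := H.exists_preimage hu
  have : P.hinv om u = Classical.choose hex := by
    simp only [hinv, not_le.2 hu, if_false, dif_pos hex]
  rw [this]
  exact Classical.choose_spec hex

/-- `startInv` is monotone above `r₀`. [folklore] -/
theorem startInv_mono {u v : ℝ} (hu : P.r₀s om < u) (huv : u ≤ v) :
    startInv P.σ 6 (P.r₀s om) u ≤ startInv P.σ 6 (P.r₀s om) v := by
  have hσ := H.σ_pos
  rw [startInv_of_lt hσ (by norm_num) hu, startInv_of_lt hσ (by norm_num) (lt_of_lt_of_le hu huv)]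
  have h1 : -(2 * P.σ * 6 ^ 2 / (u - P.r₀s om)) ≤ -(2 * P.σ * 6 ^ 2 / (v - P.r₀s om)) := by
    rw [neg_le_neg_iff]
    exact div_le_div_of_nonneg_left (by positivity) (by linarith) (by linarith)
  have h2 := Real.exp_le_exp.2 h1
  have h3 : 0 < P.σ * Real.exp 6 := by positivity
  nlinarith

/-- **`f (h u) = u` and `σ < h u` for `u > r₀⋆`.** [cite: ForstnericKozak2003, Prop. 3.1] -/
theorem f_hinv {u : ℝ} (hu : P.r₀s om < u) :
    P.σ < P.hinv om u ∧ P.ff om (P.βs om) (P.r₀s om) (P.hinv om u) = u := by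
  have hσ := H.σ_pos
  obtain ⟨hts, hts2⟩ := H.σ_lt_ts
  set ts := P.t₂ * (1 - om) with htsdef
  rcases le_or_gt u (P.ff om (P.βs om) (P.r₀s om) ts) with hle | hgt
  · rw [hinv_of_le_fts hle]
    have h1 : P.σ < startInv P.σ 6 (P.r₀s om) u := lt_startInv hσ (by norm_num) hu
    -- `startInv u ≤ startInv (f ts) = ts`
    have hLts : 0 < startLog P.σ 6 (ts - P.σ) := startLog_pos_of_lt hts (by linarith)
    have h2 : startInv P.σ 6 (P.r₀s om) u ≤ ts := by
      have h3 := H.startInv_mono hu hle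
      rwa [H.f_eq_startFn hts le_rfl, startInv_startFn hσ (by norm_num) hts hLts] at h3
    refine ⟨h1, ?_⟩
    rw [H.f_eq_startFn h1 h2, startFn_startInv hσ (by norm_num) hu]
  · obtain ⟨h1, h2⟩ := H.hinv_spec_of_gt hgt
    exact ⟨lt_trans hts h1, h2⟩

/-- **`h (f t) = t` for `t > σ`.** [cite: ForstnericKozak2003, Prop. 3.1] -/
theorem hinv_f {t : ℝ} (ht : P.σ < t) : P.hinv om (P.ff om (P.βs om) (P.r₀s om) t) = t := by
  have hu := H.r₀_lt_f ht
  obtain ⟨h1, h2⟩ := H.f_hinv hu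
  exact H.strictMonoOn_f.injOn h1 ht h2

/-- **`h u = σ` for `u ≤ r₀⋆`.** [cite: ForstnericKozak2003, Prop. 3.1] -/
theorem hinv_of_le_r₀ {u : ℝ} (hu : u ≤ P.r₀s om) : P.hinv om u = P.σ := by
  obtain ⟨hts, -⟩ := H.σ_lt_ts
  have hle : u ≤ P.ff om (P.βs om) (P.r₀s om) (P.t₂ * (1 - om)) := hu.trans (H.r₀_lt_f hts).le
  rw [hinv_of_le_fts hle, startInv_of_le H.σ_pos (by norm_num) hu]

omit H in
/-- Near every `u < f(t₂(1-ω))`, `h = startInv`. [folklore] -/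
theorem hinv_eventuallyEq_startInv {u : ℝ} (hu : u < P.ff om (P.βs om) (P.r₀s om) (P.t₂ * (1 - om))) :
    P.hinv om =ᶠ[𝓝 u] startInv P.σ 6 (P.r₀s om) := by
  filter_upwards [Iio_mem_nhds hu] with v hv using hinv_of_le_fts hv.le

/-- `σ ≤ h`. [folklore] -/
theorem σ_le_hinv (u : ℝ) : P.σ ≤ P.hinv om u := by
  rcases le_or_gt u (P.r₀s om) with h | h
  · rw [H.hinv_of_le_r₀ h]
  · exact (H.f_hinv h).1.le

/-- **Continuity of `h` above `r₀⋆`** (inverse of a continuous strictly increasing function).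
[folklore] -/
theorem continuousAt_hinv {u : ℝ} (hu : P.r₀s om < u) : ContinuousAt (P.hinv om) u := by
  rw [Metric.continuousAt_iff]
  intro e he
  set t₀ := P.hinv om u with ht₀
  obtain ⟨hσt₀, hft₀⟩ := H.f_hinv hu
  -- points `t₋ < t₀ < t₊` in `(σ, ∞)` within `e`
  set tm := max (t₀ - e / 2) ((P.σ + t₀) / 2) with htm
  set tp := t₀ + e / 2 with htp
  have htm1 : P.σ < tm := lt_of_lt_of_le (by linarith) (le_max_right _ _)
  have htm2 : tm < t₀ := max_lt (by linarith) (by linarith)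
  have htp1 : t₀ < tp := by rw [htp]; linarith
  set f := P.ff om (P.βs om) (P.r₀s om) with hf
  have hfm : f tm < u := by rw [← hft₀]; exact H.strictMonoOn_f htm1 hσt₀ htm2
  have hfp : u < f tp := by rw [← hft₀]; exact H.strictMonoOn_f hσt₀ (lt_trans hσt₀ htp1) htp1
  refine ⟨min (u - f tm) (f tp - u), lt_min (by linarith) (by linarith), fun v hv => ?_⟩
  rw [Real.dist_eq] at hv ⊢
  obtain ⟨hva, hvb⟩ := lt_min_iff.1 hv
  rw [abs_lt] at hva hvb
  have hv1 : f tm < v := by linarith [hva.1]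
  have hv2 : v < f tp := by linarith [hvb.2]
  have hvr : P.r₀s om < v := lt_trans (H.r₀_lt_f htm1) hv1
  obtain ⟨hσv, hfv⟩ := H.f_hinv hvr
  -- `tm < hinv v < tp` by strict monotonicity
  have h1 : tm < P.hinv om v := by
    by_contra hc
    have := H.strictMonoOn_f.monotoneOn hσv htm1 (not_lt.1 hc)
    rw [hfv] at this; linarith
  have h2 : P.hinv om v < tp := by
    by_contra hc
    have := H.strictMonoOn_f.monotoneOn (lt_trans hσt₀ htp1) hσv (not_lt.1 hc)
    rw [hfv] at this; linarith
  rw [abs_lt]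
  have htm3 : t₀ - e / 2 ≤ tm := le_max_left _ _
  constructor <;> linarith

/-- **`h' = 1/(f' ∘ h)` on `u > r₀⋆`.** [cite: ForstnericKozak2003, Remark 2.3 (A)] -/
theorem hasDerivAt_hinv {u : ℝ} (hu : P.r₀s om < u) :
    HasDerivAt (P.hinv om) (P.fp om (P.βs om) (P.hinv om u))⁻¹ u := by
  obtain ⟨hσt, hft⟩ := H.f_hinv hu
  have hf : HasDerivAt (P.ff om (P.βs om) (P.r₀s om)) (P.fp om (P.βs om) (P.hinv om u)) (P.hinv om u) :=
    H.hasDerivAt_f hσt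
  have hfh : ∀ᶠ y in 𝓝 u, P.ff om (P.βs om) (P.r₀s om) (P.hinv om y) = y := by
    filter_upwards [Ioi_mem_nhds hu] with y hy using (H.f_hinv hy).2
  exact hf.of_local_left_inverse (H.continuousAt_hinv hu) (H.fp_pos hσt).ne' hfh

/-- `h' > 0` on `u > r₀⋆`. [cite: ForstnericKozak2003, Prop. 3.1] -/
theorem deriv_hinv_pos {u : ℝ} (hu : P.r₀s om < u) : 0 < deriv (P.hinv om) u := by
  rw [(H.hasDerivAt_hinv hu).deriv]
  exact inv_pos.2 (H.fp_pos (H.f_hinv hu).1)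

/-- **`h` is `C^∞` on `u > r₀⋆`**: bootstrap from `h' = 1/(f' ∘ h)` with `f'` smooth. [folklore] -/
theorem contDiffOn_hinv_Ioi : ContDiffOn ℝ ∞ (P.hinv om) (Ioi (P.r₀s om)) := by
  have hfp : ContDiffOn ℝ ∞ (P.fp om (P.βs om)) (Ioi P.σ) := contDiffOn_fp H.small.toPos H.om_pos H.om_le _
  have hmaps : MapsTo (P.hinv om) (Ioi (P.r₀s om)) (Ioi P.σ) := fun u hu => (H.f_hinv hu).1
  have hderiv : ∀ u ∈ Ioi (P.r₀s om), deriv (P.hinv om) u = (P.fp om (P.βs om) (P.hinv om u))⁻¹ :=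
    fun u hu => (H.hasDerivAt_hinv hu).deriv
  -- all finite orders
  have hnat : ∀ n : ℕ, ContDiffOn ℝ n (P.hinv om) (Ioi (P.r₀s om)) := by
    intro n
    induction n with
    | zero =>
      rw [Nat.cast_zero, contDiffOn_zero]
      exact fun u hu => (H.continuousAt_hinv hu).continuousWithinAt
    | succ n ih =>
      rw [show ((n + 1 : ℕ) : WithTop ℕ∞) = (n : WithTop ℕ∞) + 1 by push_cast; ring,
        contDiffOn_succ_iff_deriv_of_isOpen isOpen_Ioi]
      refine ⟨fun u hu => (H.hasDerivAt_hinv hu).differentiableAt.differentiableWithinAt, by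
        intro h; exact absurd h (by simp), ?_⟩
      have hcomp : ContDiffOn ℝ n (fun u => P.fp om (P.βs om) (P.hinv om u)) (Ioi (P.r₀s om)) :=
        (hfp.of_le (by exact_mod_cast le_top)).comp ih hmaps
      have hinv' : ContDiffOn ℝ n (fun u => (P.fp om (P.βs om) (P.hinv om u))⁻¹) (Ioi (P.r₀s om)) :=
        hcomp.inv fun u hu => (H.fp_pos (hmaps hu)).ne'
      exact hinv'.congr hderiv
  exact contDiffOn_infty.2 hnat

/-- **`h` is `C^∞` on `ℝ`.** [cite: ForstnericKozak2003, Prop. 3.1] -/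
theorem contDiff_hinv : ContDiff ℝ ∞ (P.hinv om) := by
  rw [contDiff_iff_contDiffAt]
  intro u
  rcases lt_or_ge u (P.ff om (P.βs om) (P.r₀s om) (P.t₂ * (1 - om))) with hu | hu
  · exact (contDiff_startInv (n := ⊤)).contDiffAt.congr_of_eventuallyEq (hinv_eventuallyEq_startInv hu)
  · have hr : P.r₀s om < u := lt_of_lt_of_le (H.r₀_lt_f H.σ_lt_ts.1) hu
    exact H.contDiffOn_hinv_Ioi.contDiffAt (Ioi_mem_nhds hr)

/-- **On the quadric: `h u = √((u² - 1)/λ)` for `u ≥ g(ε(1+ω))`.** [cite: ForstnericKozak2003, Prop. 3.1] -/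
theorem hinv_eq_of_ge {u : ℝ} (hu : quadric P.l (P.ε * (1 + om)) ≤ u) :
    P.hinv om u = Real.sqrt ((u ^ 2 - 1) / P.l) := by
  have hl : 0 < P.l := by linarith [H.small.toPos.one_lt_l]
  set T := P.ε * (1 + om) with hT
  have hT0 : 0 < T := lt_trans H.σ_pos H.σ_lt_T
  have hgT : 0 < quadric P.l T := quadric_pos hl.le T
  have hu0 : 0 < u := lt_of_lt_of_le hgT hu
  set t := Real.sqrt ((u ^ 2 - 1) / P.l) with ht
  -- `u² ≥ g(T)² = λT² + 1`, so `t ≥ T`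
  have hu2 : P.l * T ^ 2 + 1 ≤ u ^ 2 := by
    have := quadric_sq hl.le T
    nlinarith [mul_self_le_mul_self hgT.le hu]
  have harg : 0 ≤ (u ^ 2 - 1) / P.l := div_nonneg (by nlinarith) hl.le
  have htT : T ≤ t := by
    rw [ht, ← Real.sqrt_sq hT0.le]
    apply Real.sqrt_le_sqrt
    rw [le_div_iff₀ hl]; nlinarith
  have hgt : quadric P.l t = u := by
    rw [quadric]
    have : P.l * t ^ 2 + 1 = u ^ 2 := by
      rw [ht, Real.sq_sqrt harg]; field_simp; ring
    rw [this, Real.sqrt_sq hu0.le]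
  have hft : P.ff om (P.βs om) (P.r₀s om) t = u := by
    rw [ff_eq_quadric H.small.toPos H.om_pos H.om_le htT, hgt]
  rw [← hft, H.hinv_f (lt_of_lt_of_le H.σ_lt_T htT)]

/-- `h u < ε(1+ω)` for `u < g(ε(1+ω))` (the handlebody lies in `D ∪ {|x| < ε(1+ω)}`).
[cite: ForstnericKozak2003, Cor. 3.2] -/
theorem hinv_lt_T {u : ℝ} (hu : u < quadric P.l (P.ε * (1 + om))) : P.hinv om u < P.ε * (1 + om) := by
  rcases le_or_gt u (P.r₀s om) with h | h
  · rw [H.hinv_of_le_r₀ h]; exact H.σ_lt_T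
  · obtain ⟨hσt, hft⟩ := H.f_hinv h
    by_contra hc
    have h1 := H.strictMonoOn_f.monotoneOn H.σ_lt_T hσt (not_lt.1 hc)
    rw [hft, ff_eq_quadric H.small.toPos H.om_pos H.om_le le_rfl] at h1
    linarith

/-! ### The inequalities (3.1) -/

/-- **(3.1) of Forstnerič–Kozak for the inverse profile, at every `u`:**
`h (h'' + h'³/u) < 1` and `h h'/u < 1`. [cite: ForstnericKozak2003, Prop. 3.1] -/
theorem hinv_shape_ineq (u : ℝ) :
    P.hinv om u * (deriv (deriv (P.hinv om)) u + deriv (P.hinv om) u ^ 3 / u) < 1 ∧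
      P.hinv om u * deriv (P.hinv om) u / u < 1 := by
  have hσ := H.σ_pos
  obtain ⟨hts, hts2⟩ := H.σ_lt_ts
  rcases lt_or_ge u (P.ff om (P.βs om) (P.r₀s om) (P.t₂ * (1 - om))) with hu | hu
  · -- flat start: `h = startInv` near `u`
    have hev := hinv_eventuallyEq_startInv hu
    have hd1 : deriv (P.hinv om) u = deriv (startInv P.σ 6 (P.r₀s om)) u := hev.deriv_eq
    have hd2 : deriv (deriv (P.hinv om)) u = deriv (deriv (startInv P.σ 6 (P.r₀s om))) u := by
      have : deriv (P.hinv om) =ᶠ[𝓝 u] deriv (startInv P.σ 6 (P.r₀s om)) := by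
        filter_upwards [hev.eventually_nhds] with v hv
        exact (show P.hinv om =ᶠ[𝓝 v] startInv P.σ 6 (P.r₀s om) from hv).deriv_eq
      exact this.deriv_eq
    rw [hev.self_of_nhds, hd1, hd2]
    rcases le_or_gt u (P.r₀s om) with h | h
    · exact startInv_shape_ineq_of_le hσ (by norm_num) h
    · apply startInv_shape_ineq hσ (by norm_num) H.σ_lt_r₀ h
      -- `startInv u ≤ t₂(1-ω) ≤ 2σ`
      have hLts : 0 < startLog P.σ 6 (P.t₂ * (1 - om) - P.σ) := startLog_pos_of_lt hts (by linarith)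
      have h3 := H.startInv_mono h hu.le
      rw [H.f_eq_startFn hts le_rfl, startInv_startFn hσ (by norm_num) hts hLts] at h3
      linarith
  · -- `u > r₀`: Remark 2.3 (A)
    have hur : P.r₀s om < u := lt_of_lt_of_le (H.r₀_lt_f hts) hu
    have hu0 : 0 < u := lt_trans (lt_trans hσ H.σ_lt_r₀) hur
    obtain ⟨hσt, hft⟩ := H.f_hinv hur
    have hh : ∀ᶠ y in 𝓝 u, ContinuousAt (P.hinv om) y := by
      filter_upwards [Ioi_mem_nhds hur] with y hy using H.continuousAt_hinv hy
    have hfd : ∀ᶠ x in 𝓝 (P.hinv om u),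
        HasDerivAt (P.ff om (P.βs om) (P.r₀s om)) (P.fp om (P.βs om) x) x := by
      filter_upwards [Ioi_mem_nhds hσt] with x hx using H.hasDerivAt_f hx
    have hp0 : 0 < P.fp om (P.βs om) (P.hinv om u) := H.fp_pos hσt
    have hfpd : HasDerivAt (P.fp om (P.βs om)) (P.φ om (P.βs om) (P.hinv om u)) (P.hinv om u) :=
      hasDerivAt_fp H.small.toPos H.om_pos H.om_le _ hσt
    have hfh : ∀ᶠ y in 𝓝 u, P.ff om (P.βs om) (P.r₀s om) (P.hinv om y) = y := by
      filter_upwards [Ioi_mem_nhds hur] with y hy using (H.f_hinv hy).2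
    have key := (shape_inverse_iff (f := P.ff om (P.βs om) (P.r₀s om)) (f' := P.fp om (P.βs om))
      (h := P.hinv om) hu0 (lt_trans hσ hσt) hh hfd rfl hp0 hfpd.continuousAt hfpd hfh).1
    apply key
    have hs := H.shape (P.hinv om u) hσt
    rw [hft] at hs
    exact hs

end ProfileOK

/-! ### Forstnerič–Kozak's Prop. 3.1 / Eliashberg's Lemma 3.4.3 for the assembled profile -/

/-- **Eliashberg's handle profile (Forstnerič–Kozak 2003, Prop. 3.1; Eliashberg 1990,
Lemma 3.4.3).**  For every `λ > 1` and every sufficiently small `ε > 0` there are `σ ∈ (0, ε)`,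
`r₀ > σ`, a width `τ ∈ (ε, 2ε)` and a `C^∞` function `h : ℝ → ℝ` — the profile of the handlebody
`K = {x + iy ∈ ℂ² : |x| ≤ h(|y|)}` with centre `D_λ ∪ M`, `D_λ = {|y|² ≥ λ|x|² + 1}`,
`M = {iy : |y| ≤ 1}` — such that: `h = σ` on `u ≤ r₀` (the tube around the core disc),
`σ ≤ h`, `h' > 0` on `u > r₀`, `h(u) = √((u² - 1)/λ)` for `u ≥ √(λτ² + 1)` (there `K` is
`D_λ`), `h < τ` below that (so `K ⊂ D_λ ∪ {|x| < τ}`), and the inequalities (3.1),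
`h (h'' + h'³/u) < 1`, `h h'/u < 1`, hold at every `u` (strong pseudoconvexity of `∂K`,
Cor. 2.2). [cite: ForstnericKozak2003, Prop. 3.1] -/
theorem exists_handle_profile {l : ℝ} (hl : 1 < l) :
    ∀ᶠ ε in 𝓝[>] (0 : ℝ), ∃ σ r₀ τ : ℝ, ∃ h : ℝ → ℝ,
      0 < σ ∧ σ < ε ∧ σ < r₀ ∧ ε < τ ∧ τ < 2 * ε ∧ ContDiff ℝ ∞ h ∧
      (∀ u, u ≤ r₀ → h u = σ) ∧ (∀ u, σ ≤ h u) ∧ (∀ u, r₀ < u → 0 < deriv h u) ∧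
      (∀ u, quadric l τ ≤ u → h u = Real.sqrt ((u ^ 2 - 1) / l)) ∧
      (∀ u, u < quadric l τ → h u < τ) ∧
      (∀ u, h u * (deriv (deriv h) u + deriv h u ^ 3 / u) < 1 ∧ h u * deriv h u / u < 1) := by
  filter_upwards [profileOK_eventually hl] with ε hε
  obtain ⟨om, H⟩ := hε.exists
  set P : HParam := ⟨l, ε⟩ with hP
  have hεp : 0 < ε := H.small.toPos.ε_pos
  refine ⟨P.σ, P.r₀s om, ε * (1 + om), P.hinv om, H.σ_pos, ?_, H.σ_lt_r₀, by nlinarith [H.om_pos],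
    by nlinarith [H.om_le], H.contDiff_hinv, fun u hu => H.hinv_of_le_r₀ hu, H.σ_le_hinv,
    fun u hu => H.deriv_hinv_pos hu, fun u hu => H.hinv_eq_of_ge hu, fun u hu => H.hinv_lt_T hu,
    H.hinv_shape_ineq⟩
  have := H.small.toPos.σ_lt_ε
  show P.σ < ε
  have hPε : P.ε = ε := rfl
  linarith

end HParam

/-! ## Forstnerič–Kozak's Cor. 3.2 / Eliashberg's Lemma 3.4.3 in `ℂ²` -/

/-- **Eliashberg's strongly pseudoconvex handlebody around `D_λ ∪ M` in `ℂ²`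
(Forstnerič–Kozak 2003, Prop. 3.1 + Cor. 3.2; Eliashberg 1990, Lemma 3.4.3).**  For `λ > 1`
and all small `ε > 0` there are `0 < σ < ε`, `r₀ > σ`, `τ ∈ (ε, 2ε)` and a profile `h` with
`HandleProfile h σ r₀` (hence `K = {|x| ≤ h(|y|)}` is a strongly pseudoconvex handlebody,
`HandleProfile.levi_handleDomain_pos`), `h' > 0` above `r₀`,
`h(u) = √((u² - 1)/λ)` for `u ≥ √(λτ² + 1)` (there `K = D_λ`) and `h < τ` below
(`K ⊂ D_λ ∪ {|x| < τ}`). [cite: ForstnericKozak2003, Cor. 3.2] -/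
theorem exists_handleProfile {l : ℝ} (hl : 1 < l) :
    ∀ᶠ ε in 𝓝[>] (0 : ℝ), ∃ σ r₀ τ : ℝ, ∃ h : ℝ → ℝ,
      HandleProfile h σ r₀ ∧ σ < ε ∧ σ < r₀ ∧ ε < τ ∧ τ < 2 * ε ∧
      (∀ u, r₀ < u → 0 < deriv h u) ∧
      (∀ u, quadric l τ ≤ u → h u = Real.sqrt ((u ^ 2 - 1) / l)) ∧
      (∀ u, u < quadric l τ → h u < τ) := by
  filter_upwards [HParam.exists_handle_profile hl] with ε hε
  obtain ⟨σ, r₀, τ, h, hσ, hσε, hσr, hετ, hτ, hsm, heq, hge, hder, htail, hlt, hshape⟩ := hε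
  exact ⟨σ, r₀, τ, h,
    { smooth := hsm
      σ_pos := hσ
      r₀_pos := lt_trans hσ hσr
      eq_σ := heq
      σ_le := hge
      shape := fun u _ => hshape u },
    hσε, hσr, hετ, hτ, hder, htail, hlt⟩

/-! ### The handlebody agrees with the quadric domain away from the core -/

/-- **Tail agreement at the level of the profile**: if `h u = √((u² - 1)/λ)` for
`u ≥ √(λτ² + 1)` and `h u < τ` below, then for `r ≥ τ` (`r = |x|`) and `u ≥ 0` (`u = |y|`),
`r ≤ h(u) ↔ λ r² + 1 ≤ u²`; i.e. `K ∩ {|x| ≥ τ} = D_λ ∩ {|x| ≥ τ}`.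
[cite: ForstnericKozak2003, Cor. 3.2] -/
theorem handle_tail_iff {l τ : ℝ} {h : ℝ → ℝ} (hl : 0 < l) (hτ : 0 ≤ τ)
    (htail : ∀ u, quadric l τ ≤ u → h u = Real.sqrt ((u ^ 2 - 1) / l))
    (hlt : ∀ u, u < quadric l τ → h u < τ) {r u : ℝ} (hr : τ ≤ r) (hu : 0 ≤ u) :
    r ≤ h u ↔ l * r ^ 2 + 1 ≤ u ^ 2 := by
  have hr0 : 0 ≤ r := hτ.trans hr
  have hq : quadric l τ = Real.sqrt (l * τ ^ 2 + 1) := rfl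
  constructor
  · intro hrh
    have hge : quadric l τ ≤ u := by
      by_contra hc
      have := hlt u (not_le.1 hc)
      linarith
    rw [htail u hge] at hrh
    have harg : 0 ≤ (u ^ 2 - 1) / l := by
      apply div_nonneg _ hl.le
      have h1 : Real.sqrt (l * τ ^ 2 + 1) ≤ u := hge
      have h2 : l * τ ^ 2 + 1 ≤ u ^ 2 := by
        have h3 := Real.sq_sqrt (by positivity : (0:ℝ) ≤ l * τ ^ 2 + 1)
        nlinarith [Real.sqrt_nonneg (l * τ ^ 2 + 1)]
      nlinarith
    have h4 : r ^ 2 ≤ (u ^ 2 - 1) / l := by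
      have := Real.sq_sqrt harg
      nlinarith [Real.sqrt_nonneg ((u ^ 2 - 1) / l)]
    rw [le_div_iff₀ hl] at h4
    nlinarith
  · intro hD
    have hge : quadric l τ ≤ u := by
      rw [hq, ← Real.sqrt_sq hu]
      apply Real.sqrt_le_sqrt
      have h5 : l * τ ^ 2 ≤ l * r ^ 2 := mul_le_mul_of_nonneg_left (by nlinarith) hl.le
      linarith
    rw [htail u hge, ← Real.sqrt_sq hr0]
    apply Real.sqrt_le_sqrt
    rw [le_div_iff₀ hl]
    nlinarith

/-- **`K ∩ {|x| ≥ τ} = D_λ ∩ {|x| ≥ τ}` in `ℂ² = ℝ⁴`** (`x = (u₀, u₁)`, `y = (u₂, u₃)`,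
`K = {ρ_K ≤ 0}`, `ρ_K = |x|² - h(|y|)²`, `D_λ = {|y|² ≥ λ|x|² + 1}`): the handlebody is the
quadric domain away from `{|x| < τ}`, so that `K` glues to `D_λ` (and to any domain osculating
`D_λ` there) along the open overlap `{|x| > τ}` without corners. [cite: ForstnericKozak2003, Cor. 3.2] -/
theorem handleDomain_eq_quadric_of_le {l τ : ℝ} {h : ℝ → ℝ} (hl : 0 < l) (hτ : 0 ≤ τ)
    (hpos : ∀ u, 0 < h u)
    (htail : ∀ u, quadric l τ ≤ u → h u = Real.sqrt ((u ^ 2 - 1) / l))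
    (hlt : ∀ u, u < quadric l τ → h u < τ) {w : EuclideanSpace ℝ (Fin 4)}
    (hw : τ ^ 2 ≤ w 0 ^ 2 + w 1 ^ 2) :
    spherical (thetaK h) w ≤ 0 ↔ l * (w 0 ^ 2 + w 1 ^ 2) + 1 ≤ w 2 ^ 2 + w 3 ^ 2 := by
  set r := Real.sqrt (w 0 ^ 2 + w 1 ^ 2) with hr
  set u := Real.sqrt (w 2 ^ 2 + w 3 ^ 2) with hu
  have hr2 : r ^ 2 = w 0 ^ 2 + w 1 ^ 2 := Real.sq_sqrt (by positivity)
  have hu2 : u ^ 2 = w 2 ^ 2 + w 3 ^ 2 := Real.sq_sqrt (by positivity)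
  have hτr : τ ≤ r := by
    rw [hr, ← Real.sqrt_sq hτ]; exact Real.sqrt_le_sqrt hw
  have key := handle_tail_iff hl hτ htail hlt hτr (Real.sqrt_nonneg _ : 0 ≤ u)
  rw [spherical_apply, thetaK_apply, ← hu, ← hr2, ← hu2, ← key, sub_nonpos]
  have hh := hpos u
  constructor
  · intro h1
    nlinarith [Real.sqrt_nonneg (w 0 ^ 2 + w 1 ^ 2)]
  · intro h1
    nlinarith [Real.sqrt_nonneg (w 0 ^ 2 + w 1 ^ 2)]

/-- **`K ⊂ D_λ ∪ {|x| < τ}`.** [cite: ForstnericKozak2003, Cor. 3.2] -/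
theorem handleDomain_subset {l τ : ℝ} {h : ℝ → ℝ} (hl : 0 < l) (hτ : 0 ≤ τ)
    (hpos : ∀ u, 0 < h u)
    (htail : ∀ u, quadric l τ ≤ u → h u = Real.sqrt ((u ^ 2 - 1) / l))
    (hlt : ∀ u, u < quadric l τ → h u < τ) {w : EuclideanSpace ℝ (Fin 4)}
    (hK : spherical (thetaK h) w ≤ 0) :
    l * (w 0 ^ 2 + w 1 ^ 2) + 1 ≤ w 2 ^ 2 + w 3 ^ 2 ∨ w 0 ^ 2 + w 1 ^ 2 < τ ^ 2 := by
  rcases le_or_gt (τ ^ 2) (w 0 ^ 2 + w 1 ^ 2) with hw | hw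
  · exact Or.inl ((handleDomain_eq_quadric_of_le hl hτ hpos htail hlt hw).1 hK)
  · exact Or.inr hw

/-- **Forstnerič–Kozak's Cor. 3.2 in `ℂ²`, packaged** (Eliashberg 1990, Lemma 3.4.3 for
`n = 2`): for `λ > 1` and all small `ε > 0` there is a profile `h` (`HandleProfile h σ r₀`,
`0 < σ < ε`, `τ ∈ (ε, 2ε)`) whose handlebody `K = {ρ_K ≤ 0} ⊂ ℂ² = ℝ⁴`,
`ρ_K = |x|² - h(|y|)²` (`spherical (thetaK h)`; `x = (u₀,u₁)`, `y = (u₂,u₃)`, `J₁∂_{u₀} = ∂_{u₂}`)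
(i) has strongly pseudoconvex boundary at every point (`HandleProfile.levi_handleDomain_pos`),
(ii) coincides with the quadric domain `D_λ = {λ|x|² + 1 ≤ |y|²}` on `{|x| ≥ τ}` and lies in
`D_λ ∪ {|x| < τ}`, (iii) contains the tube `{|x| ≤ σ}` hence the core disc `{x = 0, |y| ≤ 1}`,
and (iv) admits, near every compact part `∂K ∩ B̄(0,R)` of its boundary, the strictly
`J₁`-plurisubharmonic defining functions `e^{Cρ_K}`, `C ≥ C₀(R)`.
[cite: ForstnericKozak2003, Cor. 3.2] [cite: Eliashberg1990Stein, Lemma 3.4.3] -/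
theorem exists_steinHandlebody {l : ℝ} (hl : 1 < l) :
    ∀ᶠ ε in 𝓝[>] (0 : ℝ), ∃ σ r₀ τ : ℝ, ∃ h : ℝ → ℝ,
      HandleProfile h σ r₀ ∧ σ < ε ∧ ε < τ ∧ τ < 2 * ε ∧
      (∀ w : EuclideanSpace ℝ (Fin 4), τ ^ 2 ≤ w 0 ^ 2 + w 1 ^ 2 →
        (spherical (thetaK h) w ≤ 0 ↔ l * (w 0 ^ 2 + w 1 ^ 2) + 1 ≤ w 2 ^ 2 + w 3 ^ 2)) ∧
      (∀ w : EuclideanSpace ℝ (Fin 4), spherical (thetaK h) w ≤ 0 →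
        l * (w 0 ^ 2 + w 1 ^ 2) + 1 ≤ w 2 ^ 2 + w 3 ^ 2 ∨ w 0 ^ 2 + w 1 ^ 2 < τ ^ 2) ∧
      (∀ w : EuclideanSpace ℝ (Fin 4), w 0 ^ 2 + w 1 ^ 2 ≤ σ ^ 2 → spherical (thetaK h) w ≤ 0) ∧
      (∀ R : ℝ, ∃ U : Set (EuclideanSpace ℝ (Fin 4)), IsOpen U ∧
        {w | spherical (thetaK h) w = 0} ∩ Metric.closedBall 0 R ⊆ U ∧
        ∃ C₀ : ℝ, 0 < C₀ ∧ ∀ C : ℝ, C₀ ≤ C → ∀ w ∈ U, ∀ u : EuclideanSpace ℝ (Fin 4), u ≠ 0 →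
          0 < -(extDeriv (dComplexFlat (scaledComplexStructure 1) fun y =>
            Real.exp (C * spherical (thetaK h) y)) w ![u, scaledComplexStructure 1 u])) := by
  have hl0 : 0 < l := by linarith
  filter_upwards [exists_handleProfile hl, self_mem_nhdsWithin] with ε hε hε0
  obtain ⟨σ, r₀, τ, h, H, hσε, hσr, hετ, hτ2, hder, htail, hlt⟩ := hε
  have hε0' : 0 < ε := hε0
  have hτ0 : 0 ≤ τ := by linarith
  refine ⟨σ, r₀, τ, h, H, hσε, hετ, hτ2,
    fun w hw => handleDomain_eq_quadric_of_le hl0 hτ0 H.pos htail hlt hw,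
    fun w hw => handleDomain_subset hl0 hτ0 H.pos htail hlt hw,
    fun w hw => ?_, fun R => H.exists_psh_definingFunction R⟩
  -- the tube `{|x| ≤ σ}` lies in `K` since `h ≥ σ > 0`
  rw [spherical_apply, thetaK_apply, sub_nonpos]
  have h1 := H.σ_le (Real.sqrt (w 2 ^ 2 + w 3 ^ 2))
  have h2 := H.σ_pos
  nlinarith

end Literature.Geometry.Symplectic

end
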